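import Mathlib.Data.Real.Basic
import Mathlib.Algebra.Order.Field.Basic
import Mathlib.Algebra.BigOperators.Ring.Finset
import Mathlib.Algebra.Order.BigOperators.Group.Finset
import Mathlib.Tactic.Linarith
import Mathlib.Tactic.Positivity
import Mathlib.Tactic.Ring
import Mathlib.Tactic.FieldSimp
import HarnessLib

/-!
# `NoHeavyLowerTail` (stmt-CriticalPhenomena-4575) — the UNIFIED (two-moment) certificate for unavoidable big-piece variance

Support file (prover prim-ineq-gen-8 gen 47; `--supports stmt-CriticalPhenomena-4575`; memo
run/shared/lean/prim/prim-ineq-gen-8/FINDING-gen47-POTENTIAL.md §6(e)).  Pure finite-sum real algebra: no definitions, no named facts, no sorries.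

SETTING.  As in `…APLVwCoreCertificate.lean`, but the structure entered with probability `φ_t` (a heavy vertex, a wired core, or a GATE vertex
with its pendant part) has first and second load moments `μ₁, μ₂` given entry: `a_t ≥ μ₁ φ_t`, `b_t ≥ μ₂ φ_t` at every state, and is
"size-biased heavy": `μ₂ > m μ₁`.  (Core: `μ₁ = Λ`, `μ₂ = Λ²`; gate `g`: `μ₁ = E L^pend_g`, `μ₂ = E (L^pend_g)²`.)

THIS FILE proves [this work]  **`X_big ≥ (μ₁²/(μ₂ − m μ₁)) · (μ₂ Σ_t ν_t φ_t² − m Σ_t ν_t φ_t a_t)`**  (`two_moment_certificate`, and its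
positive-part form), which for `μ₁ = ℓ`, `μ₂ = ℓ²` is `core_certificate`.  Read: `X_big(T) ≥ μ₁² (Var I_g − (m/μ₂) Cov(I_g, L))⁺ / (1 − m μ₁/μ₂)`
for every gate `g` (adjacent explorations) — the certificate that repairs the only failure of (L_β′) found at n = 6 (memo §6(e)).
-/

noncomputable section

namespace Summit.CriticalPhenomena.PercolationContinuityZ3.Theorems

namespace APL

open Finset
open scoped BigOperators

/-- **Two-moment certificate (finite-sum form).**  Let `ν, φ ≥ 0`, `a ≥ μ₁ φ`, `b ≥ μ₂ φ` termwise on a finite set `s`, `0 ≤ m`, `0 < μ₁`,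
`m μ₁ < μ₂`.  Then the `ν a²`-mass of the BIG indices (`m a_t < b_t`) is at least `(μ₁²/(μ₂ − m μ₁)) (μ₂ Σ ν φ² − m Σ ν φ a)`. [this work] -/
theorem two_moment_certificate {ι : Type*} (s : Finset ι) (ν a b φ : ι → ℝ) (μ₁ μ₂ m : ℝ) (hm : 0 ≤ m) (hμ₁ : 0 < μ₁)
    (hμ : m * μ₁ < μ₂)
    (hν : ∀ t ∈ s, 0 ≤ ν t) (hφ : ∀ t ∈ s, 0 ≤ φ t) (ha : ∀ t ∈ s, μ₁ * φ t ≤ a t) (hb : ∀ t ∈ s, μ₂ * φ t ≤ b t) :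
    μ₁ ^ 2 / (μ₂ - m * μ₁) * (μ₂ * ∑ t ∈ s, ν t * φ t ^ 2 - m * ∑ t ∈ s, ν t * φ t * a t)
      ≤ ∑ t ∈ s.filter (fun t => m * a t < b t), ν t * a t ^ 2 := by
  classical
  have hμ₂ : 0 < μ₂ := lt_of_le_of_lt (by positivity) hμ
  have hden : 0 < μ₂ - m * μ₁ := by linarith
  set Big := s.filter (fun t => m * a t < b t) with hBig
  set Sm := s.filter (fun t => ¬ (m * a t < b t)) with hSm
  have split_φ2 : ∑ t ∈ s, ν t * φ t ^ 2 = ∑ t ∈ Big, ν t * φ t ^ 2 + ∑ t ∈ Sm, ν t * φ t ^ 2 := by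
    rw [hBig, hSm, Finset.sum_filter_add_sum_filter_not]
  have split_φa : ∑ t ∈ s, ν t * φ t * a t = ∑ t ∈ Big, ν t * φ t * a t + ∑ t ∈ Sm, ν t * φ t * a t := by
    rw [hBig, hSm, Finset.sum_filter_add_sum_filter_not]
  -- (1) small states: ν φ² ≤ (m/μ₂) ν φ a
  have h1 : ∑ t ∈ Sm, ν t * φ t ^ 2 ≤ m / μ₂ * ∑ t ∈ Sm, ν t * φ t * a t := by
    rw [Finset.mul_sum]
    refine Finset.sum_le_sum fun t ht => ?_
    have hts : t ∈ s := (Finset.mem_filter.mp ht).1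
    have hsmall : b t ≤ m * a t := not_lt.mp (Finset.mem_filter.mp ht).2
    have hφt := hφ t hts; have hνt := hν t hts
    have hφle : φ t ≤ m * a t / μ₂ := by
      rw [le_div_iff₀ hμ₂]
      calc φ t * μ₂ = μ₂ * φ t := by ring
        _ ≤ b t := hb t hts
        _ ≤ m * a t := hsmall
    have : ν t * φ t * φ t ≤ ν t * φ t * (m * a t / μ₂) :=
      mul_le_mul_of_nonneg_left hφle (mul_nonneg hνt hφt)
    calc ν t * φ t ^ 2 = ν t * φ t * φ t := by ring
      _ ≤ ν t * φ t * (m * a t / μ₂) := this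
      _ = m / μ₂ * (ν t * φ t * a t) := by field_simp
  -- (2) big states: ν φ a ≥ μ₁ ν φ²  and  ν a² ≥ μ₁² ν φ²
  have h2 : μ₁ * ∑ t ∈ Big, ν t * φ t ^ 2 ≤ ∑ t ∈ Big, ν t * φ t * a t := by
    rw [Finset.mul_sum]
    refine Finset.sum_le_sum fun t ht => ?_
    have hts : t ∈ s := (Finset.mem_filter.mp ht).1
    have hφt := hφ t hts; have hνt := hν t hts
    have : ν t * φ t * (μ₁ * φ t) ≤ ν t * φ t * a t := mul_le_mul_of_nonneg_left (ha t hts) (mul_nonneg hνt hφt)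
    calc μ₁ * (ν t * φ t ^ 2) = ν t * φ t * (μ₁ * φ t) := by ring
      _ ≤ ν t * φ t * a t := this
  have h3 : μ₁ ^ 2 * ∑ t ∈ Big, ν t * φ t ^ 2 ≤ ∑ t ∈ Big, ν t * a t ^ 2 := by
    rw [Finset.mul_sum]
    refine Finset.sum_le_sum fun t ht => ?_
    have hts : t ∈ s := (Finset.mem_filter.mp ht).1
    have hφt := hφ t hts; have hνt := hν t hts
    have hℓφ : 0 ≤ μ₁ * φ t := mul_nonneg hμ₁.le hφt
    have hsq : (μ₁ * φ t) ^ 2 ≤ a t ^ 2 := by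
      have := ha t hts
      nlinarith
    calc μ₁ ^ 2 * (ν t * φ t ^ 2) = ν t * (μ₁ * φ t) ^ 2 := by ring
      _ ≤ ν t * a t ^ 2 := mul_le_mul_of_nonneg_left hsq hνt
  set u := ∑ t ∈ Big, ν t * φ t ^ 2 with hu
  set P := ∑ t ∈ s, ν t * φ t ^ 2 with hP
  set C := ∑ t ∈ s, ν t * φ t * a t with hC
  have hsm_φa : ∑ t ∈ Sm, ν t * φ t * a t = C - ∑ t ∈ Big, ν t * φ t * a t := by linarith [split_φa]
  have key : P - u ≤ m / μ₂ * (C - μ₁ * u) := by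
    have hmon : m / μ₂ * ∑ t ∈ Sm, ν t * φ t * a t ≤ m / μ₂ * (C - μ₁ * u) := by
      apply mul_le_mul_of_nonneg_left _ (by positivity)
      rw [hsm_φa]; linarith [h2]
    linarith [split_φ2, h1, hmon]
  -- μ₂ (P − u) ≤ m (C − μ₁ u)  ⟹  (μ₂ − m μ₁) u ≥ μ₂ P − m C
  have k3 : μ₂ * (P - u) ≤ m * (C - μ₁ * u) := by
    have := mul_le_mul_of_nonneg_left key hμ₂.le
    have e : μ₂ * (m / μ₂ * (C - μ₁ * u)) = m * (C - μ₁ * u) := by field_simp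
    linarith [this, e]
  have key2 : μ₁ ^ 2 / (μ₂ - m * μ₁) * (μ₂ * P - m * C) ≤ μ₁ ^ 2 * u := by
    rw [div_mul_eq_mul_div, div_le_iff₀ hden]
    have hμ₁2 : 0 ≤ μ₁ ^ 2 := by positivity
    nlinarith [k3, hμ₁2]
  linarith [key2, h3]

/-- Positive-part form of `two_moment_certificate`. [this work] -/
theorem two_moment_certificate_pos {ι : Type*} (s : Finset ι) (ν a b φ : ι → ℝ) (μ₁ μ₂ m : ℝ) (hm : 0 ≤ m) (hμ₁ : 0 < μ₁)
    (hμ : m * μ₁ < μ₂)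
    (hν : ∀ t ∈ s, 0 ≤ ν t) (hφ : ∀ t ∈ s, 0 ≤ φ t) (ha : ∀ t ∈ s, μ₁ * φ t ≤ a t) (hb : ∀ t ∈ s, μ₂ * φ t ≤ b t) :
    max (μ₁ ^ 2 / (μ₂ - m * μ₁) * (μ₂ * ∑ t ∈ s, ν t * φ t ^ 2 - m * ∑ t ∈ s, ν t * φ t * a t)) 0
      ≤ ∑ t ∈ s.filter (fun t => m * a t < b t), ν t * a t ^ 2 := by
  refine max_le (two_moment_certificate s ν a b φ μ₁ μ₂ m hm hμ₁ hμ hν hφ ha hb) ?_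
  refine Finset.sum_nonneg fun t ht => ?_
  have hts : t ∈ s := (Finset.mem_filter.mp ht).1
  exact mul_nonneg (hν t hts) (sq_nonneg _)

end APL

end Summit.CriticalPhenomena.PercolationContinuityZ3.Theorems

end
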